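import Mathlib
import Literature.Computability.AlgebraicComplexity.GroupTheoreticMatMul

set_option linter.dupNamespace false

/-!
# Stub `stub_boxTransport` — carry-free box transport of STPP families into `(ZMod m)^D`

Crux `stmt-MatrixMultiplication-10595` (`Theses.ThinBlockAlpha.ThinPackings`), line
`three-sphere-frame-designs`.

An STPP family (`Literature.Computability.AlgebraicComplexity.IsSTPP A B C`, the tree predicate of
`Literature/Computability/AlgebraicComplexity/GroupTheoreticMatMul.lean`) of integer vectors
supported in the sup-norm box `[-R, R]^D` stays STPP, with the same cardinalities, after
coordinatewise reduction modulo any `m > 6R`, i.e. under the map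
`φ x := fun t => (x t : ZMod m) : (Fin D → ℤ) → (Fin D → ZMod m)`.

Proof: the single clause of `IsSTPP` is the signed relation `(s' - s) + (t' - t) + (u' - u) = 0`
among six vectors of the box.  Elements of the image sets pull back to box vectors
(`Finset.mem_image`); a reduced relation holds coordinatewise, and at each coordinate the integer
combination `z` has `|z| ≤ 6R < m` and reduces to `0` modulo `m`, hence `z = 0`
(`Int.eq_zero_of_abs_lt_dvd`, `ZMod.intCast_zmod_eq_zero_iff_dvd`).  So the integer clause fires
and its conclusions push forward to the images.  The map `φ` is injective on every box set (two
box vectors with equal reductions differ by a box relation of the same shape), which gives the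
cardinalities (`Finset.card_image_of_injOn`).

The helpers are adapted from `Theorems/ThinBlockAlphaThinPackingsStubBoxFreiman.lean` (the
label-weighted variant of the same transport, same map, same box).
-/

namespace Summit.MatrixMultiplication.MatrixMultiplication.Theorems.ThinPackings

open Finset
open Literature.Computability.AlgebraicComplexity (IsSTPP)

section BoxTransportHelpers

variable {D R m : ℕ}

-- adapted from ThinBlockAlphaThinPackingsStubBoxFreiman.lean (`int_eq_zero_of_cast_eq_zero`)
/-- An integer of absolute value `< m` whose reduction modulo `m` vanishes is zero. -/
private theorem boxT_int_eq_zero {z : ℤ} (hz : (z : ZMod m) = 0) (hlt : |z| < (m : ℤ)) :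
    z = 0 :=
  Int.eq_zero_of_abs_lt_dvd ((ZMod.intCast_zmod_eq_zero_iff_dvd z m).1 hz) hlt

-- adapted from ThinBlockAlphaThinPackingsStubBoxFreiman.lean (`reflect6`)
/-- **Six-term reflection.** If six vectors of the box `[-R, R]^D` satisfy the relation
`(s' - s) + (t' - t) + (u' - u) = 0` after coordinatewise reduction modulo `m > 6R`, then they
satisfy it in `ℤ^D`. -/
private theorem boxT_reflect6 {φ : (Fin D → ℤ) → (Fin D → ZMod m)}
    (hφ : ∀ v c, φ v c = (v c : ZMod m)) (hRm : 6 * R < m) {s s' t t' u u' : Fin D → ℤ}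
    (h : φ s' - φ s + (φ t' - φ t) + (φ u' - φ u) = 0)
    (hs : ∀ c, |s c| ≤ (R : ℤ)) (hs' : ∀ c, |s' c| ≤ (R : ℤ)) (ht : ∀ c, |t c| ≤ (R : ℤ))
    (ht' : ∀ c, |t' c| ≤ (R : ℤ)) (hu : ∀ c, |u c| ≤ (R : ℤ)) (hu' : ∀ c, |u' c| ≤ (R : ℤ)) :
    s' - s + (t' - t) + (u' - u) = 0 := by
  funext c
  simp only [Pi.add_apply, Pi.sub_apply, Pi.zero_apply]
  refine boxT_int_eq_zero (m := m) ?_ ?_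
  · have hc := congr_fun h c
    simp only [Pi.add_apply, Pi.sub_apply, Pi.zero_apply, hφ] at hc
    exact_mod_cast hc
  · have h1 := abs_le.1 (hs c)
    have h2 := abs_le.1 (hs' c)
    have h3 := abs_le.1 (ht c)
    have h4 := abs_le.1 (ht' c)
    have h5 := abs_le.1 (hu c)
    have h6 := abs_le.1 (hu' c)
    rw [abs_lt]
    constructor <;> omega

-- adapted from ThinBlockAlphaThinPackingsStubBoxFreiman.lean (`injOn_box`)
/-- The coordinatewise reduction modulo `m > 6R` is injective on every subset of the box
`[-R, R]^D`. -/
private theorem boxT_injOn {φ : (Fin D → ℤ) → (Fin D → ZMod m)}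
    (hφ : ∀ v c, φ v c = (v c : ZMod m)) (hRm : 6 * R < m) {S : Finset (Fin D → ℤ)}
    (hS : ∀ v ∈ S, ∀ c, |v c| ≤ (R : ℤ)) : Set.InjOn φ S := by
  intro v hv w hw hvw
  have h0 : φ v - φ w + (φ v - φ v) + (φ v - φ v) = 0 := by linear_combination hvw
  have h1 := boxT_reflect6 hφ hRm h0 (hS w hw) (hS v hv) (hS v hv) (hS v hv) (hS v hv) (hS v hv)
  linear_combination h1

/-- **Transport of an STPP family** along any map `φ` which is the coordinatewise reduction
modulo `m > 6R`, for families supported in the box `[-R, R]^D`: the image family is STPP and the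
cardinalities are preserved. -/
private theorem boxT_transport (φ : (Fin D → ℤ) → (Fin D → ZMod m))
    (hφ : ∀ v c, φ v c = (v c : ZMod m)) (hRm : 6 * R < m) {L : ℕ}
    {A B C : Fin L → Finset (Fin D → ℤ)}
    (hA : ∀ i, ∀ x ∈ A i, ∀ t, |x t| ≤ (R : ℤ)) (hB : ∀ i, ∀ y ∈ B i, ∀ t, |y t| ≤ (R : ℤ))
    (hC : ∀ i, ∀ z ∈ C i, ∀ t, |z t| ≤ (R : ℤ)) (hS : IsSTPP A B C) :
    IsSTPP (fun i => (A i).image φ) (fun i => (B i).image φ) (fun i => (C i).image φ) ∧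
      ∀ i, ((A i).image φ).card = (A i).card ∧ ((B i).image φ).card = (B i).card ∧
        ((C i).image φ).card = (C i).card := by
  refine ⟨?_, fun i => ⟨card_image_of_injOn (boxT_injOn hφ hRm (hA i)),
    card_image_of_injOn (boxT_injOn hφ hRm (hB i)),
    card_image_of_injOn (boxT_injOn hφ hRm (hC i))⟩⟩
  intro i j k s hs s' hs' t ht t' ht' u hu u' hu' he
  obtain ⟨s₀, hs₀, rfl⟩ := mem_image.1 hs
  obtain ⟨s₁, hs₁, rfl⟩ := mem_image.1 hs'
  obtain ⟨t₀, ht₀, rfl⟩ := mem_image.1 ht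
  obtain ⟨t₁, ht₁, rfl⟩ := mem_image.1 ht'
  obtain ⟨u₀, hu₀, rfl⟩ := mem_image.1 hu
  obtain ⟨u₁, hu₁, rfl⟩ := mem_image.1 hu'
  have he' := boxT_reflect6 hφ hRm he (hA k s₀ hs₀) (hA i s₁ hs₁) (hB i t₀ ht₀) (hB j t₁ ht₁)
    (hC j u₀ hu₀) (hC k u₁ hu₁)
  obtain ⟨hij, hjk, hss, htt, huu⟩ := hS i j k s₀ hs₀ s₁ hs₁ t₀ ht₀ t₁ ht₁ u₀ hu₀ u₁ hu₁ he'
  exact ⟨hij, hjk, by rw [hss], by rw [htt], by rw [huu]⟩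

end BoxTransportHelpers

/-- **Carry-free box transport** (stub `stub_boxTransport` of line `three-sphere-frame-designs`):
an STPP family of integer vectors supported in the sup-norm box `[-R, R]^D` stays STPP, with the
same cardinalities, after coordinatewise reduction modulo any `m > 6R`. [new, elementary] -/
theorem stub_boxTransport :
    ∀ (D R m L : ℕ) (A B C : Fin L → Finset (Fin D → ℤ)), 6 * R < m →
      (∀ i, ∀ x ∈ A i, ∀ t, |x t| ≤ (R : ℤ)) → (∀ i, ∀ y ∈ B i, ∀ t, |y t| ≤ (R : ℤ)) →
      (∀ i, ∀ z ∈ C i, ∀ t, |z t| ≤ (R : ℤ)) →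
      Literature.Computability.AlgebraicComplexity.IsSTPP A B C →
      Literature.Computability.AlgebraicComplexity.IsSTPP
          (fun i => (A i).image fun (x : Fin D → ℤ) (t : Fin D) => ((x t : ℤ) : ZMod m))
          (fun i => (B i).image fun (x : Fin D → ℤ) (t : Fin D) => ((x t : ℤ) : ZMod m))
          (fun i => (C i).image fun (x : Fin D → ℤ) (t : Fin D) => ((x t : ℤ) : ZMod m)) ∧
        ∀ i, ((A i).image fun (x : Fin D → ℤ) (t : Fin D) => ((x t : ℤ) : ZMod m)).card
              = (A i).card ∧
            ((B i).image fun (x : Fin D → ℤ) (t : Fin D) => ((x t : ℤ) : ZMod m)).card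
              = (B i).card ∧
            ((C i).image fun (x : Fin D → ℤ) (t : Fin D) => ((x t : ℤ) : ZMod m)).card
              = (C i).card :=
  fun D _R m _L _A _B _C hRm hA hB hC hS =>
    boxT_transport (fun (x : Fin D → ℤ) (t : Fin D) => ((x t : ℤ) : ZMod m)) (fun _ _ => rfl)
      hRm hA hB hC hS

end Summit.MatrixMultiplication.MatrixMultiplication.Theorems.ThinPackings
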